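import Mathlib
import HarnessLib
import Literature.Computability.AlgebraicComplexity.BigCwFourthOmega
import Summits.MatrixMultiplication.MatrixMultiplication.Theorems.OutsiderSandwichSlopeDialExchange
import Summits.MatrixMultiplication.MatrixMultiplication.Theorems.OutsiderSandwichResidualRate

/-!
# OutsiderSandwich — THE INTEGER SQUARE PRICE `p₁ ∈ {4, 5, 6}` of `⟨4,4,4⟩` in laser-floor currency:
the minimal criminal of the square-exchange family is one integer, and its first undecided rung is ONE
named restriction (decomp-mm lens 4 «minimal counterexample / extremal reduction», gen 36, part 4)

Route `route-MatrixMultiplication-OutsiderSandwich`; cut of record UNCHANGED: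
`closes (h₁ : LaserTangency) (h₂ : LaserMergeOptimal) (h₃ : SummitIffLaserTangency) : ω(ℂ) = 2`,
`LaserMergeOptimal` (stmt-27897) the declared residual; theorem-only, definition-free support.
Notation (parts 2–3): `T(ℂ)`, `≲`, `a = [⟨2,2,2⟩]`, `c = [cw₂]`, the square exchanges
`E = {(p, q) ∈ ℕ² : 27q·a² ≲ 4p·c³}` and the square rate `σ* = max_{φ ∈ X(T(ℂ))} φ(27a²)/φ(4c³) ∈ [4, 2^ω]`
(`exists_squareRate`: `σ* = inf` of the rates of `E`, `LaserMergeOptimal ⟺ σ* = 2^ω`).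

* §1 `E` IS A HALF-PLANE (`squareExchange_iff_rate`): `(p, q) ∈ E ⟺ q·σ* ≤ p ⟺ ⌈q·σ*⌉ ≤ p` — the whole
  family is ONE real number; `(p, q) ∈ E` whenever `q·2^ω ≤ p` (`squareExchange_of_rpow_omega_le`,
  unconditional: floor + `R̃(a) = 2^ω`), hence **`27·[⟨2,2,2⟩]² ≲ 24·[cw₂]³` is a THEOREM**
  (`squareExchange_six_one`, from `ω ≤ 2.37295` [cite: LeGall2014, Table 2 and §6.3]: `2^ω < 6`).
* §2 THE RUNG `(4, 1)` IS g31's FLOOR(2/3) (`floorTwoThirds_iff_squareExchange_four_one`):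
  `27·[⟨2,2,2⟩]² ≲ 16·[cw₂]³ ⟺ SlopeFloor cw₂ (log₂3) (2/3)`; it implies `LaserTangency` and
  **`ω = 2 ⟺ (27·[⟨2,2,2⟩]² ≲ 16·[cw₂]³) ∧ LaserMergeOptimal`** (the dial at slopes `1/3 < 2/3`): the summit
  is `σ* = 4 = 2^ω` — FLOOR(2/3) `⟺ σ* = 4` IMPLIES the attacked binder `h₁ = LaserTangency` (not conversely,
  as far as we know), the residual `h₂ ⟺ σ* = 2^ω` — and `σ*` dominates g35's bundled price `2^{τ*}`
  (`tight_le_squareRate`: `F(a) ≤ σ*` at tight `F`; so `LaserTangency ⟺ 2^{τ*} = 4 ⟸ σ* = 4`).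
* §3 THE INTEGER SQUARE PRICE (`exists_squarePrice`): `p₁ := min {p : (p,1) ∈ E}` exists, `4 ≤ p₁ ≤ 6`,
  `(p,1) ∈ E ⟺ p₁ ≤ p`; `FLOOR(2/3) ⟺ p₁ = 4`; `ω = 2 ⟺ p₁ = 4 ∧ LaserMergeOptimal`; `p₁ ≤ ⌈2^ω⌉` always and
  **the residual pins `p₁ = ⌈2^ω⌉`**; `p₁ < 2^ω` refutes the residual.  The first undecided rung is
  `(5, 1)`: **`27·[⟨2,2,2⟩]^{⊠2} ≲ 20·[cw₂]^{⊠3}`** is implied by `ω ≤ log₂5` and implies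
  `LaserMergeOptimal → ω ≤ log₂5 ≈ 2.3219` (`omega_le_logb_five_of_squareExchange_five_one`) — a concrete
  asymptotic restriction whose certification would, GIVEN the residual, beat the `ω` record by `0.049`.

Honest tags: support only; nothing finite is decided (every rung is an asymptotic restriction; a finite-level
restriction `20^N·2^{o(N)} ⊙ cw₂^{⊗3N} ⊵ 27^N ⊙ ⟨4^N,4^N,4^N⟩` would certify the rung `(5,1)`, none is claimed).
Nearest prior art: g31 `OutsiderSandwichSlopeDialExchange.cwFloor_twoThirds_iff` (the rung `(4,1)` at
universal points, marked open there); Fritz 2017 (arXiv:1504.03661) Thm. 8.24; new here: the CAP side and the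
integer `p₁` with its unconditional window `{4,5,6}`.
References: [cite: Strassen1988, Thm. 2.3–2.4, Thm. 3.8]; [cite: Zuiddam2018, Thm. 2.12, Cor. 2.13, Thm. 2.15];
[cite: CoppersmithWinograd1990, §6]; [cite: LeGall2014, Table 2 and §6.3]; [cite: ChristandlVranaZuiddam2023,
§1.2, Thm. 4.20].
-/

set_option linter.dupNamespace false

noncomputable section

namespace Summit.MatrixMultiplication.MatrixMultiplication.Theorems.OutsiderSandwichSquarePrice

open Literature.Computability.AlgebraicComplexity
open Summit.MatrixMultiplication.MatrixMultiplication.Theses.OutsiderSandwich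
open Summit.MatrixMultiplication.MatrixMultiplication.Theorems.OutsiderSandwichContactFace
  (gaugePoint₁_cwTensor_two gaugePoint₁_matMulTensor_two)
open Summit.MatrixMultiplication.MatrixMultiplication.Theorems.OutsiderSandwichSlopeDialCore
  (SlopeFloor SlopeCap)
open Summit.MatrixMultiplication.MatrixMultiplication.Theorems.OutsiderSandwichSlopeDial
  (cwFloor_one_iff summit_iff_cwDial cwCap_third_iff laserTangency_of_cwFloor)
open Summit.MatrixMultiplication.MatrixMultiplication.Theorems.OutsiderSandwichSlopeDialExchange
  (cwFloor_twoThirds_iff)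
open Summit.MatrixMultiplication.MatrixMultiplication.Theorems.OutsiderSandwichFaceCertificates
open Summit.MatrixMultiplication.MatrixMultiplication.Theorems.OutsiderSandwichBundledPrice
open Summit.MatrixMultiplication.MatrixMultiplication.Theorems.OutsiderSandwichSubsidy
open Summit.MatrixMultiplication.MatrixMultiplication.Theorems.OutsiderSandwichProductLocalisation
open Summit.MatrixMultiplication.MatrixMultiplication.Theorems.OutsiderSandwichExchange
open Summit.MatrixMultiplication.MatrixMultiplication.Theorems.OutsiderSandwichResidualRate

variable {F : SpectralMap ℂ}

/-! ## §1  `E` is a half-plane; unconditional rungs -/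

/-- `φ(4c³) > 0` on `X(T(ℂ))`. [cite: Strassen1988, Thm. 3.8] -/
theorem laserV_pos : ∀ ψ : TensorClass ℂ → ℝ, IsSpectralPoint (fun x y : TensorClass ℂ => x ≤ y) ψ →
    0 < ψ (((4 : ℕ) : TensorClass ℂ) * TensorClass.mk (cwTensor ℂ 2) ^ 3) := by
  intro ψ hψ
  rw [hψ.map_mul, hψ.map_natCast, hψ.map_pow]
  have := cw_pos ψ hψ
  positivity

/-- The `(p, q)`-form of a square exchange is the `q·(27a²) ≲ p·(4c³)` form. -/
theorem squareExchange_iff_mulForm (p q : ℕ) :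
    AsympLe (fun x y : TensorClass ℂ => x ≤ y)
        (((27 * q : ℕ) : TensorClass ℂ) * TensorClass.mk (matMulTensor ℂ 2 2 2) ^ 2)
        (((4 * p : ℕ) : TensorClass ℂ) * TensorClass.mk (cwTensor ℂ 2) ^ 3) ↔
      AsympLe (fun x y : TensorClass ℂ => x ≤ y)
        ((q : TensorClass ℂ) * (((27 : ℕ) : TensorClass ℂ) * TensorClass.mk (matMulTensor ℂ 2 2 2) ^ 2))
        ((p : TensorClass ℂ) * (((4 : ℕ) : TensorClass ℂ) * TensorClass.mk (cwTensor ℂ 2) ^ 3)) := by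
  have e1 : ((27 * q : ℕ) : TensorClass ℂ) * TensorClass.mk (matMulTensor ℂ 2 2 2) ^ 2 =
      (q : TensorClass ℂ) * (((27 : ℕ) : TensorClass ℂ) * TensorClass.mk (matMulTensor ℂ 2 2 2) ^ 2) := by
    push_cast; ring
  have e2 : ((4 * p : ℕ) : TensorClass ℂ) * TensorClass.mk (cwTensor ℂ 2) ^ 3 =
      (p : TensorClass ℂ) * (((4 : ℕ) : TensorClass ℂ) * TensorClass.mk (cwTensor ℂ 2) ^ 3) := by
    push_cast; ring
  rw [e1, e2]

/-- **`E` IS A HALF-PLANE over the square rate.**  For any maximiser `φ₀` of `φ(27a²)/φ(4c³)` on `X(T(ℂ))`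
(it exists: `exists_squareRate`): `(p, q) ∈ E ⟺ q·σ* ≤ p ⟺ ⌈q·σ*⌉ ≤ p`.
[cite: Zuiddam2018, Thm. 2.12; Strassen1988, Thm. 3.8] -/
theorem squareExchange_iff_rate {φ₀ : TensorClass ℂ → ℝ}
    (hφ₀ : IsSpectralPoint (fun x y : TensorClass ℂ => x ≤ y) φ₀)
    (hmax : ∀ ψ, IsSpectralPoint (fun x y : TensorClass ℂ => x ≤ y) ψ →
      ψ (((27 : ℕ) : TensorClass ℂ) * TensorClass.mk (matMulTensor ℂ 2 2 2) ^ 2) /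
          ψ (((4 : ℕ) : TensorClass ℂ) * TensorClass.mk (cwTensor ℂ 2) ^ 3) ≤
        φ₀ (((27 : ℕ) : TensorClass ℂ) * TensorClass.mk (matMulTensor ℂ 2 2 2) ^ 2) /
          φ₀ (((4 : ℕ) : TensorClass ℂ) * TensorClass.mk (cwTensor ℂ 2) ^ 3))
    (p q : ℕ) :
    (AsympLe (fun x y : TensorClass ℂ => x ≤ y)
        (((27 * q : ℕ) : TensorClass ℂ) * TensorClass.mk (matMulTensor ℂ 2 2 2) ^ 2)
        (((4 * p : ℕ) : TensorClass ℂ) * TensorClass.mk (cwTensor ℂ 2) ^ 3) ↔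
      (q : ℝ) * (φ₀ (((27 : ℕ) : TensorClass ℂ) * TensorClass.mk (matMulTensor ℂ 2 2 2) ^ 2) /
          φ₀ (((4 : ℕ) : TensorClass ℂ) * TensorClass.mk (cwTensor ℂ 2) ^ 3)) ≤ p) ∧
    (AsympLe (fun x y : TensorClass ℂ => x ≤ y)
        (((27 * q : ℕ) : TensorClass ℂ) * TensorClass.mk (matMulTensor ℂ 2 2 2) ^ 2)
        (((4 * p : ℕ) : TensorClass ℂ) * TensorClass.mk (cwTensor ℂ 2) ^ 3) ↔
      ⌈(q : ℝ) * (φ₀ (((27 : ℕ) : TensorClass ℂ) * TensorClass.mk (matMulTensor ℂ 2 2 2) ^ 2) /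
          φ₀ (((4 : ℕ) : TensorClass ℂ) * TensorClass.mk (cwTensor ℂ 2) ^ 3))⌉₊ ≤ p) := by
  have h0 := laserV_pos φ₀ hφ₀
  have key : AsympLe (fun x y : TensorClass ℂ => x ≤ y)
        (((27 * q : ℕ) : TensorClass ℂ) * TensorClass.mk (matMulTensor ℂ 2 2 2) ^ 2)
        (((4 * p : ℕ) : TensorClass ℂ) * TensorClass.mk (cwTensor ℂ 2) ^ 3) ↔
      (q : ℝ) * (φ₀ (((27 : ℕ) : TensorClass ℂ) * TensorClass.mk (matMulTensor ℂ 2 2 2) ^ 2) /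
          φ₀ (((4 : ℕ) : TensorClass ℂ) * TensorClass.mk (cwTensor ℂ 2) ^ 3)) ≤ p := by
    rw [squareExchange_iff_mulForm, exchange_iff_forall (TensorClass.isStrassenPreorder ℂ)]
    constructor
    · intro H
      have h1 := H φ₀ hφ₀
      rw [mul_div_assoc', div_le_iff₀ h0]
      exact h1
    · intro H ψ hψ
      have hψ0 := laserV_pos ψ hψ
      have h1 := hmax ψ hψ
      rw [div_le_iff₀ hψ0] at h1
      have h2 : (q : ℝ) * ψ (((27 : ℕ) : TensorClass ℂ) * TensorClass.mk (matMulTensor ℂ 2 2 2) ^ 2) ≤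
          (q : ℝ) * (φ₀ (((27 : ℕ) : TensorClass ℂ) * TensorClass.mk (matMulTensor ℂ 2 2 2) ^ 2) /
            φ₀ (((4 : ℕ) : TensorClass ℂ) * TensorClass.mk (cwTensor ℂ 2) ^ 3)) *
            ψ (((4 : ℕ) : TensorClass ℂ) * TensorClass.mk (cwTensor ℂ 2) ^ 3) := by
        rw [mul_assoc]; exact mul_le_mul_of_nonneg_left h1 (Nat.cast_nonneg q)
      exact h2.trans (mul_le_mul_of_nonneg_right H hψ0.le)
  exact ⟨key, by rw [key, Nat.ceil_le]⟩

/-- **Unconditional rungs**: `q·2^ω ≤ p ⟹ (p, q) ∈ E` (laser floor times `φ(a) ≤ R̃(a) = 2^ω`).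
[cite: CoppersmithWinograd1990, §6; Zuiddam2018, Cor. 2.13; Strassen1988, Thm. 3.8] -/
theorem squareExchange_of_rpow_omega_le {p q : ℕ} (h : (q : ℝ) * (2 : ℝ) ^ omega ℂ ≤ p) :
    AsympLe (fun x y : TensorClass ℂ => x ≤ y)
      (((27 * q : ℕ) : TensorClass ℂ) * TensorClass.mk (matMulTensor ℂ 2 2 2) ^ 2)
      (((4 * p : ℕ) : TensorClass ℂ) * TensorClass.mk (cwTensor ℂ 2) ^ 3) := by
  refine (TensorClass.isStrassenPreorder ℂ).asympLe_of_forall_spectralPoint _ _ fun φ hφ => ?_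
  obtain ⟨h1, h2⟩ := matMul_mem_Icc φ hφ
  have hfl := laserFloor_valid φ hφ
  rw [hφ.map_mul, hφ.map_mul, hφ.map_natCast, hφ.map_natCast, hφ.map_pow] at hfl
  rw [hφ.map_mul, hφ.map_mul, hφ.map_natCast, hφ.map_natCast, hφ.map_pow, hφ.map_pow]
  push_cast at hfl ⊢
  have hc := (cw_pos φ hφ).le
  have ha : 0 ≤ φ (TensorClass.mk (matMulTensor ℂ 2 2 2)) := by linarith
  have h3 : 27 * φ (TensorClass.mk (matMulTensor ℂ 2 2 2)) ^ 2 ≤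
      (2 : ℝ) ^ omega ℂ * (4 * φ (TensorClass.mk (cwTensor ℂ 2)) ^ 3) := by
    nlinarith [mul_le_mul h2 hfl (by positivity) (by positivity)]
  nlinarith [mul_le_mul_of_nonneg_right h (by positivity : (0 : ℝ) ≤ 4 * φ (TensorClass.mk (cwTensor ℂ 2)) ^ 3),
    mul_le_mul_of_nonneg_left h3 (Nat.cast_nonneg q)]

/-- `E` is upward closed in the price `p`. [cite: Zuiddam2018, Thm. 2.12] -/
theorem squareExchange_mono {p p' q : ℕ}
    (hc : AsympLe (fun x y : TensorClass ℂ => x ≤ y)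
      (((27 * q : ℕ) : TensorClass ℂ) * TensorClass.mk (matMulTensor ℂ 2 2 2) ^ 2)
      (((4 * p : ℕ) : TensorClass ℂ) * TensorClass.mk (cwTensor ℂ 2) ^ 3))
    (hp : p ≤ p') :
    AsympLe (fun x y : TensorClass ℂ => x ≤ y)
      (((27 * q : ℕ) : TensorClass ℂ) * TensorClass.mk (matMulTensor ℂ 2 2 2) ^ 2)
      (((4 * p' : ℕ) : TensorClass ℂ) * TensorClass.mk (cwTensor ℂ 2) ^ 3) := by
  have hS := TensorClass.isStrassenPreorder ℂ
  refine hS.asympLe_of_forall_spectralPoint _ _ fun φ hφ => ?_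
  have h1 := (hS.asympLe_iff_forall_spectralPoint.1 hc) φ hφ
  rw [hφ.map_mul, hφ.map_mul, hφ.map_natCast, hφ.map_natCast] at h1 ⊢
  have hv : 0 ≤ φ (TensorClass.mk (cwTensor ℂ 2) ^ 3) := hφ.nonneg hS _
  have hp' : ((4 * p : ℕ) : ℝ) ≤ ((4 * p' : ℕ) : ℝ) := by exact_mod_cast Nat.mul_le_mul_left 4 hp
  nlinarith

/-- `2^ω < 6` (indeed `ω ≤ 2.37295 < 5/2` and `2^{5/2} = √32 < 6`). [cite: LeGall2014, Table 2 and §6.3] -/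
theorem two_rpow_omega_lt_six : (2 : ℝ) ^ omega ℂ < 6 := by
  have hω := LeGall2014_cw4_omega_le ℂ
  have h1 : (2 : ℝ) ^ omega ℂ ≤ (2 : ℝ) ^ ((5 : ℝ) / 2) :=
    Real.rpow_le_rpow_of_exponent_le one_le_two (by linarith)
  have h2 : ((2 : ℝ) ^ ((5 : ℝ) / 2)) ^ 2 = 32 := by
    rw [← Real.rpow_natCast, ← Real.rpow_mul (by norm_num : (0 : ℝ) ≤ 2)]
    norm_num
  have h3 : (2 : ℝ) ^ ((5 : ℝ) / 2) < 6 := by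
    have h0 : 0 ≤ (2 : ℝ) ^ ((5 : ℝ) / 2) := Real.rpow_nonneg (by norm_num) _
    nlinarith [h2, h0]
  exact lt_of_le_of_lt h1 h3

/-- **THEOREM: `27·[⟨2,2,2⟩]² ≲ 24·[cw₂]³`** — the rung `(6, 1)` holds unconditionally.
[cite: LeGall2014, Table 2 and §6.3; CoppersmithWinograd1990, §6; Zuiddam2018, Thm. 2.12, Cor. 2.13] -/
theorem squareExchange_six_one :
    AsympLe (fun x y : TensorClass ℂ => x ≤ y)
      (((27 * 1 : ℕ) : TensorClass ℂ) * TensorClass.mk (matMulTensor ℂ 2 2 2) ^ 2)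
      (((4 * 6 : ℕ) : TensorClass ℂ) * TensorClass.mk (cwTensor ℂ 2) ^ 3) :=
  squareExchange_of_rpow_omega_le (by push_cast; linarith [two_rpow_omega_lt_six])

/-! ## §2  The rung `(4, 1)` is FLOOR(2/3); the summit and `LaserTangency` through it -/

/-- **`(4, 1) ∈ E ⟺ SlopeFloor cw₂ (log₂3) (2/3)`** (`27·F(a)² ≤ 16·F(c)³` at every universal point).
[cite: Strassen1988, Thm. 3.8; Zuiddam2018, Thm. 2.12] -/
theorem floorTwoThirds_iff_squareExchange_four_one :
    SlopeFloor (cwTensor ℂ 2) (Real.logb 2 3) (2 / 3) ↔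
      AsympLe (fun x y : TensorClass ℂ => x ≤ y)
        (((27 * 1 : ℕ) : TensorClass ℂ) * TensorClass.mk (matMulTensor ℂ 2 2 2) ^ 2)
        (((4 * 4 : ℕ) : TensorClass ℂ) * TensorClass.mk (cwTensor ℂ 2) ^ 3) := by
  rw [cwFloor_twoThirds_iff, forall_univ_iff_abstract (fun s t => 27 * s ^ 2 ≤ 16 * t ^ 3),
    (TensorClass.isStrassenPreorder ℂ).asympLe_iff_forall_spectralPoint]
  refine forall₂_congr fun φ hφ => ?_
  rw [hφ.map_mul, hφ.map_mul, hφ.map_natCast, hφ.map_natCast, hφ.map_pow, hφ.map_pow]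
  push_cast
  exact Iff.rfl

/-- **The rung `(4, 1)` gives `LaserTangency`** (the attacked binder `h₁`). [cite: Strassen1988, Thm. 2.3;
CoppersmithWinograd1990, §7] -/
theorem laserTangency_of_squareExchange_four_one
    (h : AsympLe (fun x y : TensorClass ℂ => x ≤ y)
      (((27 * 1 : ℕ) : TensorClass ℂ) * TensorClass.mk (matMulTensor ℂ 2 2 2) ^ 2)
      (((4 * 4 : ℕ) : TensorClass ℂ) * TensorClass.mk (cwTensor ℂ 2) ^ 3)) :
    LaserTangency :=
  laserTangency_of_cwFloor (by norm_num : (1 : ℝ) / 3 < 2 / 3)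
    (floorTwoThirds_iff_squareExchange_four_one.2 h)

/-- **THE SUMMIT THROUGH THE RUNG `(4, 1)`**: `ω = 2 ⟺ (27·[⟨2,2,2⟩]² ≲ 16·[cw₂]³) ∧ LaserMergeOptimal`
(g31's dial at slopes `1/3 < 2/3`). [cite: Strassen1988, Thm. 2.3–2.4, Thm. 3.8; CoppersmithWinograd1990, §6] -/
theorem summit_iff_squareExchange_four_one_and_laserMergeOptimal :
    _root_.MatrixMultiplication ↔
      AsympLe (fun x y : TensorClass ℂ => x ≤ y)
        (((27 * 1 : ℕ) : TensorClass ℂ) * TensorClass.mk (matMulTensor ℂ 2 2 2) ^ 2)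
        (((4 * 4 : ℕ) : TensorClass ℂ) * TensorClass.mk (cwTensor ℂ 2) ^ 3) ∧ LaserMergeOptimal := by
  rw [summit_iff_cwDial (show (1 : ℝ) / 3 < 2 / 3 by norm_num), cwCap_third_iff,
    floorTwoThirds_iff_squareExchange_four_one]

/-- **`σ*` dominates the bundled price**: at a laser-TIGHT point `φ(a) = φ(27a²)/φ(4c³) ≤ σ*` for any
maximiser `φ₀`; so `σ* ≤ 4 ⟹ LaserTangency` and `σ* = 4 ⟺ FLOOR(2/3)`. [cite: CoppersmithWinograd1990, §6;
Strassen1988, Thm. 3.8] -/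
theorem tight_le_squareRate {φ₀ : TensorClass ℂ → ℝ}
    (hmax : ∀ ψ, IsSpectralPoint (fun x y : TensorClass ℂ => x ≤ y) ψ →
      ψ (((27 : ℕ) : TensorClass ℂ) * TensorClass.mk (matMulTensor ℂ 2 2 2) ^ 2) /
          ψ (((4 : ℕ) : TensorClass ℂ) * TensorClass.mk (cwTensor ℂ 2) ^ 3) ≤
        φ₀ (((27 : ℕ) : TensorClass ℂ) * TensorClass.mk (matMulTensor ℂ 2 2 2) ^ 2) /
          φ₀ (((4 : ℕ) : TensorClass ℂ) * TensorClass.mk (cwTensor ℂ 2) ^ 3))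
    (φ : TensorClass ℂ → ℝ) (hφ : IsSpectralPoint (fun x y : TensorClass ℂ => x ≤ y) φ)
    (htight : φ (((27 : ℕ) : TensorClass ℂ) * TensorClass.mk (matMulTensor ℂ 2 2 2)) =
      φ (((4 : ℕ) : TensorClass ℂ) * TensorClass.mk (cwTensor ℂ 2) ^ 3)) :
    φ (TensorClass.mk (matMulTensor ℂ 2 2 2)) ≤
      φ₀ (((27 : ℕ) : TensorClass ℂ) * TensorClass.mk (matMulTensor ℂ 2 2 2) ^ 2) /
        φ₀ (((4 : ℕ) : TensorClass ℂ) * TensorClass.mk (cwTensor ℂ 2) ^ 3) := by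
  have h1 := hmax φ hφ
  have hv := laserV_pos φ hφ
  have e : φ (((27 : ℕ) : TensorClass ℂ) * TensorClass.mk (matMulTensor ℂ 2 2 2) ^ 2) =
      φ (TensorClass.mk (matMulTensor ℂ 2 2 2)) *
        φ (((4 : ℕ) : TensorClass ℂ) * TensorClass.mk (cwTensor ℂ 2) ^ 3) := by
    rw [← htight, hφ.map_mul, hφ.map_mul, hφ.map_natCast, hφ.map_pow]
    ring
  rw [e, mul_div_cancel_right₀ _ hv.ne'] at h1
  exact h1

/-! ## §3  The integer square price `p₁` -/

/-- **THE INTEGER SQUARE PRICE.**  `p₁ = min {p : 27·[⟨2,2,2⟩]² ≲ 4p·[cw₂]³}` exists, `4 ≤ p₁ ≤ 6`,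
decides every rung `(p, 1)`; `FLOOR(2/3) ⟺ p₁ = 4`; `ω = 2 ⟺ p₁ = 4 ∧ LaserMergeOptimal`; `p₁ ≤ ⌈2^ω⌉`
always, the residual pins `p₁ = ⌈2^ω⌉`, and `p₁ < 2^ω` refutes the residual.
[cite: Zuiddam2018, Thm. 2.12, Cor. 2.13, Thm. 2.15; CoppersmithWinograd1990, §6; Strassen1988, Thm. 2.3–2.4,
Thm. 3.8; LeGall2014, Table 2 and §6.3] -/
theorem exists_squarePrice :
    ∃ p₁ : ℕ, 4 ≤ p₁ ∧ p₁ ≤ 6 ∧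
      (∀ p : ℕ, AsympLe (fun x y : TensorClass ℂ => x ≤ y)
          (((27 * 1 : ℕ) : TensorClass ℂ) * TensorClass.mk (matMulTensor ℂ 2 2 2) ^ 2)
          (((4 * p : ℕ) : TensorClass ℂ) * TensorClass.mk (cwTensor ℂ 2) ^ 3) ↔ p₁ ≤ p) ∧
      (SlopeFloor (cwTensor ℂ 2) (Real.logb 2 3) (2 / 3) ↔ p₁ = 4) ∧
      (_root_.MatrixMultiplication ↔ p₁ = 4 ∧ LaserMergeOptimal) ∧
      p₁ ≤ ⌈(2 : ℝ) ^ omega ℂ⌉₊ ∧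
      (LaserMergeOptimal → p₁ = ⌈(2 : ℝ) ^ omega ℂ⌉₊) ∧
      ((p₁ : ℝ) < (2 : ℝ) ^ omega ℂ → ¬ LaserMergeOptimal) := by
  classical
  have hne : ∃ p : ℕ, AsympLe (fun x y : TensorClass ℂ => x ≤ y)
      (((27 * 1 : ℕ) : TensorClass ℂ) * TensorClass.mk (matMulTensor ℂ 2 2 2) ^ 2)
      (((4 * p : ℕ) : TensorClass ℂ) * TensorClass.mk (cwTensor ℂ 2) ^ 3) := ⟨6, squareExchange_six_one⟩
  have hspec := Nat.find_spec hne
  have hmin : ∀ p : ℕ, AsympLe (fun x y : TensorClass ℂ => x ≤ y)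
      (((27 * 1 : ℕ) : TensorClass ℂ) * TensorClass.mk (matMulTensor ℂ 2 2 2) ^ 2)
      (((4 * p : ℕ) : TensorClass ℂ) * TensorClass.mk (cwTensor ℂ 2) ^ 3) ↔ Nat.find hne ≤ p :=
    fun p => ⟨fun h => Nat.find_min' hne h, fun h => squareExchange_mono hspec h⟩
  have h4 : 4 ≤ Nat.find hne := by simpa using four_mul_le_of_squareExchange hspec
  have hceil : Nat.find hne ≤ ⌈(2 : ℝ) ^ omega ℂ⌉₊ :=
    (hmin _).1 (squareExchange_of_rpow_omega_le (by rw [Nat.cast_one, one_mul]; exact Nat.le_ceil _))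
  have hfloor : SlopeFloor (cwTensor ℂ 2) (Real.logb 2 3) (2 / 3) ↔ Nat.find hne = 4 := by
    rw [floorTwoThirds_iff_squareExchange_four_one, hmin]; omega
  refine ⟨Nat.find hne, h4, (hmin 6).1 squareExchange_six_one, hmin, hfloor, ?_, hceil, ?_, ?_⟩
  · rw [summit_iff_cwDial (show (1 : ℝ) / 3 < 2 / 3 by norm_num), cwCap_third_iff, hfloor]
  · intro hL
    refine le_antisymm hceil (Nat.ceil_le.2 ?_)
    have h := rpow_omega_le_of_squareExchange hL one_pos hspec
    simpa using h
  · intro hlt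
    exact not_laserMergeOptimal_iff_cheapSquareExchange.2 ⟨Nat.find hne, 1, by simpa using hlt, hspec⟩

/-- **The first undecided rung `(5, 1)` read UNDER the residual**: `27·[⟨2,2,2⟩]² ≲ 20·[cw₂]³ ⟹
(LaserMergeOptimal → ω ≤ log₂5 ≈ 2.3219)`. [cite: Zuiddam2018, Thm. 2.12, Cor. 2.13; Strassen1988, Thm. 3.8] -/
theorem omega_le_logb_five_of_squareExchange_five_one
    (h : AsympLe (fun x y : TensorClass ℂ => x ≤ y)
      (((27 * 1 : ℕ) : TensorClass ℂ) * TensorClass.mk (matMulTensor ℂ 2 2 2) ^ 2)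
      (((4 * 5 : ℕ) : TensorClass ℂ) * TensorClass.mk (cwTensor ℂ 2) ^ 3))
    (hL : LaserMergeOptimal) : omega ℂ ≤ Real.logb 2 5 := by
  have h1 := rpow_omega_le_of_squareExchange hL one_pos h
  rw [Real.le_logb_iff_rpow_le one_lt_two (by norm_num : (0 : ℝ) < 5)]
  simpa using h1

/-- Conversely `ω ≤ log₂5 ⟹ (5, 1) ∈ E`: the rung is sandwiched between `ω ≤ log₂5` and its residual-
conditional form. [cite: CoppersmithWinograd1990, §6; Zuiddam2018, Cor. 2.13] -/
theorem squareExchange_five_one_of_omega_le (hω : omega ℂ ≤ Real.logb 2 5) :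
    AsympLe (fun x y : TensorClass ℂ => x ≤ y)
      (((27 * 1 : ℕ) : TensorClass ℂ) * TensorClass.mk (matMulTensor ℂ 2 2 2) ^ 2)
      (((4 * 5 : ℕ) : TensorClass ℂ) * TensorClass.mk (cwTensor ℂ 2) ^ 3) := by
  refine squareExchange_of_rpow_omega_le ?_
  have h1 : (2 : ℝ) ^ omega ℂ ≤ (2 : ℝ) ^ Real.logb 2 5 := Real.rpow_le_rpow_of_exponent_le one_le_two hω
  rw [Real.rpow_logb two_pos (by norm_num) (by norm_num)] at h1
  push_cast
  linarith

end Summit.MatrixMultiplication.MatrixMultiplication.Theorems.OutsiderSandwichSquarePrice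

end
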